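import Summits.AtomisticToContinuum.HydrodynamicLimit.Theorems.CollisionIsometryCLTCollisionalTransferLocalityJumpIncrements
import Literature.MathematicalPhysics.KineticTheory.EvenCollisionTubeFunctional
import Literature.MathematicalPhysics.KineticTheory.EvenStatTruncationBound
import Summits.AtomisticToContinuum.HydrodynamicLimit.Theorems.JParityClosureEvenStressEnskogRungZeroPinHelpers
import HarnessLib

/-!
# [PW-a] Window domination of the weighted collision virial by the trace even collision sums
(line `hemisphere-affine-slaving`, crux `CollisionalTransferLocality`, stmt-AtomisticToContinuum-9518)

Registered stub `stub_windowDomination` of the line lead (gen 1, seat c8), deterministic collision bookkeeping on ONE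
good hard-sphere orbit. With the cutoff `g(a) = max 0 (min 1 (2 − 2a/η_c))` (`= 1` on `[0, η_c/2]`), `χ ≡ 1` and the
trace marks `Ξ^{kk} = evenMark k k`:

* (i) the even collision sums `K_k(τ) = collisionSum σ N (Φ N) τ 1 g Ξ^{kk} r z` are nonnegative (every summand is);
* (ii) for `0 ≤ τ ≤ τ' ≤ t`, under the mollified ceiling `ρ_r ≤ 2` on `[0, t]` and `4σ³ ≤ η_c`,
  `V_N(τ') − V_N(τ) ≤ (1 + 2L) Σ_k (K_k(τ') − K_k(τ)) + T_L(t)`, `T_L(t)` the `(N+1)⁻¹`-normalised sum of `virialK`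
  over the ordered collisions in `(0, t]` with a post-collisional speed `> L`.

Collision by collision: both sides are finite sums over the collision times in `(τ, τ']` of sums over the ordered
contact pairs (`collisionPairSum_Ioc_split`, `HardSphereFlow.collisionPairSum_eq_finsum_ite`, `Icc 0 τ' = Icc 0 τ ∪ Ioc τ τ'`);
at an ordered contact pair `(i, j)` of the OUTGOING post-collisional configuration
(`IsHardSphereTrajectory.isOutgoing_of_mem_contactSet`) the pre-collisional velocities `(v_i⁻, v_j⁻) = reflectVel n (v_i, v_j)`
satisfy `⟪v_j⁻ − v_i⁻, n̂⟫ = ⟪v_i − v_j, n̂⟫ = ‖Δv_i‖ > 0` (`inner_reflectVel_fst_sub_snd`, `norm_dV_eq`), so that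
`Σ_k Ξ^{kk}(n̂, v_i⁻, v_j⁻) = ‖Δv_i‖ ‖n̂‖² = ‖Δv_i‖`, while `g(σ³ρ_r(x_i)) = 1` by the ceiling; a collision with both
speeds `≤ L` has `virialK = ε‖Δv_i‖(1 + ‖v_i‖ + ‖v_j‖) ≤ (1 + 2L) ε Σ_k Ξ^{kk}`, every other one is in `T_L`.
References: Chapman–Cowling (1970) Ch. 16 (collisional transfer); Cercignani–Illner–Pulvirenti (1994) §4.2.
-/

namespace Summit.AtomisticToContinuum.HydrodynamicLimit.Theorems.HemisphereAffineSlaving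

open scoped BigOperators Topology Classical ENNReal InnerProductSpace
open Filter Set Function MeasureTheory
open Literature.Analysis.FluidPDE

noncomputable section

open Literature.MathematicalPhysics.KineticTheory (T3 V3 hsDiameter hsDiameter_pos evenMark mollDensity
  mollDensity_nonneg_of_pos)
open Summit.AtomisticToContinuum.HydrodynamicLimit.Theorems.EvenStressEnskog (evenMark_diag_nonneg)

/-! ## One ordered contact pair -/

section OnePair

/-- The window cutoff `g(a) = max 0 (min 1 (2 − 2a/η_c))` equals `1` for `2a ≤ η_c` (`0 < η_c`). -/
theorem windowCutoff_eq_one {ηc a : ℝ} (hηc : 0 < ηc) (ha : 2 * a ≤ ηc) :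
    max 0 (min 1 (2 - 2 * a / ηc)) = 1 := by
  have h1 : 2 * a / ηc ≤ 1 := (div_le_one hηc).2 ha
  rw [min_eq_left (by linarith), max_eq_right zero_le_one]

/-- **The trace of the even marks at an outgoing contact pair is the flux weight.** For an ordered pair `(i, j)`
at contact (`‖x_i − x_j‖ = ε_N`) of an OUTGOING configuration, with `n̂ = ε_N⁻¹ n` and the pre-collisional
velocities `(v_i⁻, v_j⁻) = reflectVel n (v_i, v_j)`: `Σ_k Ξ^{kk}(n̂, v_i⁻, v_j⁻) = ‖Δv_i‖`
(`⟪v_j⁻ − v_i⁻, n̂⟫ = ⟪v_i − v_j, n̂⟫ = ‖Δv_i‖ ≥ 0` and `Σ_k n̂_k² = ‖n̂‖² = 1`). -/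
theorem sum_evenMark_diag_pre_eq_norm_dV {σ : ℝ} (hσ : 0 < σ) {N : ℕ} {w : Cfg N} {i j : Fin (N + 1)}
    (hcontact : ‖sepV N w i j‖ = hsDiameter σ N) (hout : 0 < ⟪sepV N w i j, (w i).2 - (w j).2⟫_ℝ) :
    ∑ k : Fin 3, evenMark k k ((hsDiameter σ N)⁻¹ • sepV N w i j,
        (reflectVel (sepV N w i j) ((w i).2, (w j).2)).1,
        (reflectVel (sepV N w i j) ((w i).2, (w j).2)).2) = ‖dV N w i j‖ := by
  have hε : 0 < hsDiameter σ N := hsDiameter_pos hσ N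
  have hn0 : sepV N w i j ≠ 0 := by
    intro h; rw [h, norm_zero] at hcontact; exact hε.ne hcontact
  have hω : omg N w i j = (hsDiameter σ N)⁻¹ • sepV N w i j := by rw [omg, hcontact]
  have hω1 : ‖omg N w i j‖ = 1 := norm_omg hn0
  set c : ℝ := ⟪(w i).2 - (w j).2, omg N w i j⟫_ℝ with hcdef
  have hc_eq : c = (hsDiameter σ N)⁻¹ * ⟪sepV N w i j, (w i).2 - (w j).2⟫_ℝ := by
    rw [hcdef, hω, inner_smul_right, real_inner_comm]
  have hcpos : 0 < c := by rw [hc_eq]; exact mul_pos (inv_pos.2 hε) hout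
  have hdv : ‖dV N w i j‖ = c := by
    rw [norm_dV_eq hn0, ← hcdef, abs_of_pos hcpos]
  -- the reflection flips the normal component of the relative velocity
  have hrefl : ⟪(reflectVel (sepV N w i j) ((w i).2, (w j).2)).2 -
      (reflectVel (sepV N w i j) ((w i).2, (w j).2)).1, (hsDiameter σ N)⁻¹ • sepV N w i j⟫_ℝ = c := by
    rw [inner_smul_right, ← neg_sub (reflectVel (sepV N w i j) ((w i).2, (w j).2)).1, inner_neg_left,
      real_inner_comm, inner_reflectVel_fst_sub_snd (sepV N w i j) hn0, neg_neg, hc_eq]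
  -- `Σ_k n̂_k² = ‖n̂‖² = 1`
  have hsq : ∑ k : Fin 3, ((hsDiameter σ N)⁻¹ • sepV N w i j) k * ((hsDiameter σ N)⁻¹ • sepV N w i j) k = 1 := by
    rw [← hω]
    have h := EuclideanSpace.norm_sq_eq (omg N w i j)
    rw [hω1, one_pow] at h
    rw [h]
    refine Finset.sum_congr rfl fun k _ => ?_
    rw [Real.norm_eq_abs, sq_abs, sq]
  simp only [evenMark]
  rw [hrefl, max_eq_left hcpos.le, ← Finset.mul_sum, hsq, mul_one, hdv]

/-- **The one-collision comparison.** For an ordered pair `(i, j)` at contact of an outgoing configuration `w`,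
under the ceiling `ρ_r(w, x_i) ≤ 2` (`0 < r`) and `4σ³ ≤ η_c`: the weighted virial kernel is at most `(1 + 2L)` times
`ε_N Σ_k g(σ³ρ_r(x_i)) Ξ^{kk}(n̂, v_i⁻, v_j⁻)` plus the fast tail `𝟙{‖v_i‖ > L ∨ ‖v_j‖ > L} virialK`. -/
theorem virialK_le_windowPair {σ : ℝ} (hσ : 0 < σ) {ηc r L : ℝ} (hηc : 0 < ηc) (hr : 0 < r) (hL : 0 < L)
    (hσc : 4 * σ ^ 3 ≤ ηc) {N : ℕ} {w : Cfg N} {i j : Fin (N + 1)}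
    (hcontact : ‖sepV N w i j‖ = hsDiameter σ N) (hout : 0 < ⟪sepV N w i j, (w i).2 - (w j).2⟫_ℝ)
    (hρ : mollDensity r w (w i).1 ≤ 2) (s : ℝ) :
    virialK σ N s w i j ≤
      (1 + 2 * L) * (hsDiameter σ N * ∑ k : Fin 3,
        (1 : ℝ) * max 0 (min 1 (2 - 2 * (σ ^ 3 * mollDensity r w (w i).1) / ηc)) *
          evenMark k k ((hsDiameter σ N)⁻¹ • sepV N w i j,
            (reflectVel (sepV N w i j) ((w i).2, (w j).2)).1,
            (reflectVel (sepV N w i j) ((w i).2, (w j).2)).2)) +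
      (if L < ‖(w i).2‖ ∨ L < ‖(w j).2‖ then virialK σ N s w i j else 0) := by
  have hε : 0 < hsDiameter σ N := hsDiameter_pos hσ N
  have hρ0 : 0 ≤ mollDensity r w (w i).1 := mollDensity_nonneg_of_pos hr w (w i).1
  have hσ3 : 0 < σ ^ 3 := by positivity
  have hg : max 0 (min 1 (2 - 2 * (σ ^ 3 * mollDensity r w (w i).1) / ηc)) = 1 := by
    refine windowCutoff_eq_one hηc ?_
    have h2 : σ ^ 3 * mollDensity r w (w i).1 ≤ σ ^ 3 * 2 := mul_le_mul_of_nonneg_left hρ hσ3.le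
    linarith
  simp only [hg, one_mul]
  rw [sum_evenMark_diag_pre_eq_norm_dV hσ hcontact hout]
  have hV0 : 0 ≤ virialK σ N s w i j := virialK_nonneg hσ.le N s w i j
  have hflux : 0 ≤ hsDiameter σ N * ‖dV N w i j‖ := by positivity
  by_cases hfast : L < ‖(w i).2‖ ∨ L < ‖(w j).2‖
  · rw [if_pos hfast]
    have h1 : 0 ≤ (1 + 2 * L) * (hsDiameter σ N * ‖dV N w i j‖) := by positivity
    linarith
  · rw [if_neg hfast, add_zero]
    push Not at hfast
    unfold virialK
    calc hsDiameter σ N * ‖dV N w i j‖ * (1 + ‖(w i).2‖ + ‖(w j).2‖)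
        ≤ hsDiameter σ N * ‖dV N w i j‖ * (1 + 2 * L) := by
          refine mul_le_mul_of_nonneg_left ?_ hflux
          linarith [hfast.1, hfast.2]
      _ = (1 + 2 * L) * (hsDiameter σ N * ‖dV N w i j‖) := by ring

end OnePair

/-! ## The registered stub -/

/-- **Registered stub [PW-a] `stub_windowDomination` — nonnegativity and window domination of the weighted collision
virial by the trace even collision sums.** Fix `0 < σ ≤ 1/2`, a cutoff level `η_c > 0`,
`g(a) = max 0 (min 1 (2 − 2a/η_c))`, `χ ≡ 1` and the trace marks `Ξ^{kk} = evenMark k k`. For every `0 < r < 1/4`,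
`L > 0`, flow family, `N`, GOOD initial datum `z` and horizon `t > 0` with the mollified ceiling `ρ_r(Φ_s z, x) ≤ 2` on
`[0, t]` and `4σ³ ≤ η_c`: (i) `0 ≤ K_k(τ) = collisionSum σ N (Φ N) τ 1 g Ξ^{kk} r z`; (ii) for `0 ≤ τ ≤ τ' ≤ t`,
`V_N(τ') − V_N(τ) ≤ (1 + 2L) Σ_k (K_k(τ') − K_k(τ)) + (N+1)⁻¹ Σ_{ordered collisions in (0,t], a speed > L} virialK`
(collision by collision on the good orbit: outgoing post-collisional pairs, `reflectVel` recovers the incoming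
velocities, `Σ_k Ξ^{kk}(n̂, v_i⁻, v_j⁻) = ‖Δv_i‖`, `g(σ³ρ_r) = 1` under the ceiling). [folklore; Chapman–Cowling (1970) Ch. 16] -/
theorem stub_windowDomination : ∀ (σ : ℝ), 0 < σ → σ ≤ 1 / 2 → ∀ (ηc : ℝ), 0 < ηc → ∀ (r L : ℝ), 0 < r → r < 1 / 4 → 0 < L → ∀ (Φ : Flows σ) (N : ℕ) (z : Cfg N), z ∈ (Φ N).good → ∀ t : ℝ, 0 < t → (∀ s ∈ Icc 0 t, ∀ x : T3, Literature.MathematicalPhysics.KineticTheory.mollDensity r ((Φ N).flow s z) x ≤ 2) → 4 * σ ^ 3 ≤ ηc → (∀ (k : Fin 3) (τ : ℝ), 0 ≤ Literature.MathematicalPhysics.KineticTheory.collisionSum σ N (Φ N) τ (fun _ : ℝ × T3 => (1 : ℝ)) (fun a : ℝ => max 0 (min 1 (2 - 2 * a / ηc))) (Literature.MathematicalPhysics.KineticTheory.evenMark k k) r z) ∧ (∀ τ τ' : ℝ, 0 ≤ τ → τ ≤ τ' → τ' ≤ t → virialW σ Φ N z τ' - virialW σ Φ N z τ ≤ (1 +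 2 * L) * ∑ k : Fin 3, (Literature.MathematicalPhysics.KineticTheory.collisionSum σ N (Φ N) τ' (fun _ : ℝ × T3 => (1 : ℝ)) (fun a : ℝ => max 0 (min 1 (2 - 2 * a / ηc))) (Literature.MathematicalPhysics.KineticTheory.evenMark k k) r z - Literature.MathematicalPhysics.KineticTheory.collisionSum σ N (Φ N) τ (fun _ : ℝ × T3 => (1 : ℝ)) (fun a : ℝ => max 0 (min 1 (2 - 2 * a / ηc))) (Literature.MathematicalPhysics.KineticTheory.evenMark k k) r z) + ((N : ℝ) + 1)⁻¹ * (Φ N).collisionPairSum (Ioc 0 t) (fun s w i j => if L < ‖(w i).2‖ ∨ L < ‖(w j).2‖ then virialK σ N s w i j else 0) z) := by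
  intro σ hσ _hσ2 ηc hηc r L hr _hr4 hL Φ N z hz t _ht hceil hσc
  have hε : 0 < hsDiameter σ N := hsDiameter_pos hσ N
  have htraj := (Φ N).isTrajectory z hz
  -- the kernel of `K_k` as a collision pair sum along the flow, and the fast tail kernel
  set gK : Fin 3 → ℝ → Cfg N → Fin (N + 1) → Fin (N + 1) → ℝ := fun k s w i j =>
    (1 : ℝ) * max 0 (min 1 (2 - 2 * (σ ^ 3 * mollDensity r w (w i).1) / ηc)) *
      evenMark k k ((hsDiameter σ N)⁻¹ • sepV N w i j,
        (reflectVel (sepV N w i j) ((w i).2, (w j).2)).1,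
        (reflectVel (sepV N w i j) ((w i).2, (w j).2)).2) with hgK
  set tailK : ℝ → Cfg N → Fin (N + 1) → Fin (N + 1) → ℝ := fun s w i j =>
    if L < ‖(w i).2‖ ∨ L < ‖(w j).2‖ then virialK σ N s w i j else 0 with htailK
  have hgK0 : ∀ k s w i j, 0 ≤ gK k s w i j := fun k s w i j => by
    simp only [hgK]
    exact mul_nonneg (mul_nonneg zero_le_one (le_max_left _ _)) (evenMark_diag_nonneg k _)
  have htailK0 : ∀ s w i j, 0 ≤ tailK s w i j := fun s w i j => by
    simp only [htailK]
    split_ifs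
    · exact virialK_nonneg hσ.le N s w i j
    · exact le_rfl
  -- `K_k(τ) = ε/(N+1) · CPS(Icc 0 τ) gK_k`
  have hK : ∀ (k : Fin 3) (τ : ℝ),
      Literature.MathematicalPhysics.KineticTheory.collisionSum σ N (Φ N) τ (fun _ : ℝ × T3 => (1 : ℝ))
        (fun a : ℝ => max 0 (min 1 (2 - 2 * a / ηc))) (evenMark k k) r z =
      hsDiameter σ N / ((N : ℝ) + 1) * (Φ N).collisionPairSum (Icc 0 τ) (gK k) z := by
    intro k τ
    rw [(Φ N).collisionPairSum_eq_finsum_ite hz]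
    rfl
  -- window differences of `K_k`
  have hKdiff : ∀ (k : Fin 3) {τ τ' : ℝ}, 0 ≤ τ → τ ≤ τ' →
      Literature.MathematicalPhysics.KineticTheory.collisionSum σ N (Φ N) τ' (fun _ : ℝ × T3 => (1 : ℝ))
          (fun a : ℝ => max 0 (min 1 (2 - 2 * a / ηc))) (evenMark k k) r z -
        Literature.MathematicalPhysics.KineticTheory.collisionSum σ N (Φ N) τ (fun _ : ℝ × T3 => (1 : ℝ))
          (fun a : ℝ => max 0 (min 1 (2 - 2 * a / ηc))) (evenMark k k) r z =
      hsDiameter σ N / ((N : ℝ) + 1) * (Φ N).collisionPairSum (Ioc τ τ') (gK k) z := by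
    intro k τ τ' hτ hττ'
    have hdisj : Disjoint (Icc 0 τ) (Ioc τ τ') :=
      Set.disjoint_left.2 fun x hx1 hx2 => (not_lt.2 hx1.2) hx2.1
    rw [hK, hK]
    unfold HardSphereFlow.collisionPairSum
    rw [← Icc_union_Ioc_eq_Icc hτ hττ', collisionPairSum_union (htraj.locFinite 0 τ)
      (htraj.finite_collisionTimes_inter_Ioc τ τ') hdisj]
    ring
  refine ⟨fun k τ => ?_, fun τ τ' hτ hττ' hτ't => ?_⟩
  · -- (i) nonnegativity
    rw [hK]
    refine mul_nonneg (div_nonneg hε.le (by positivity)) ?_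
    unfold HardSphereFlow.collisionPairSum
    exact collisionPairSum_nonneg fun s i j => hgK0 k s _ i j
  · -- (ii) window domination
    have hc0 : (0 : ℝ) ≤ ((N : ℝ) + 1)⁻¹ := by positivity
    have hfin := htraj.finite_collisionTimes_inter_Ioc τ τ'
    -- the tail over `(τ, τ']` is part of the tail over `(0, t]`
    have htail : (Φ N).collisionPairSum (Ioc τ τ') tailK z ≤ (Φ N).collisionPairSum (Ioc 0 t) tailK z := by
      rw [collisionPairSum_Ioc_split Φ hz (hτ.trans hττ') hτ't tailK, collisionPairSum_Ioc_split Φ hz hτ hττ' tailK]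
      have h1 : 0 ≤ (Φ N).collisionPairSum (Ioc 0 τ) tailK z :=
        collisionPairSum_nonneg fun s i j => htailK0 s _ i j
      have h2 : 0 ≤ (Φ N).collisionPairSum (Ioc τ' t) tailK z :=
        collisionPairSum_nonneg fun s i j => htailK0 s _ i j
      linarith
    -- the window comparison, collision by collision
    have hmain : (Φ N).collisionPairSum (Ioc τ τ') (virialK σ N) z ≤
        (1 + 2 * L) * (hsDiameter σ N * ∑ k : Fin 3, (Φ N).collisionPairSum (Ioc τ τ') (gK k) z) +
          (Φ N).collisionPairSum (Ioc τ τ') tailK z := by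
      unfold HardSphereFlow.collisionPairSum
      simp only [collisionPairSum_eq_finset_sum hfin]
      have htime : ∀ tc ∈ hfin.toFinset,
          ∑ p ∈ contactPairs (Torus.geometry (Fin 3)) (hsDiameter σ N) ((Φ N).flow tc z),
              virialK σ N tc ((Φ N).flow tc z) p.1 p.2 ≤
            (1 + 2 * L) * (hsDiameter σ N * ∑ k : Fin 3,
              ∑ p ∈ contactPairs (Torus.geometry (Fin 3)) (hsDiameter σ N) ((Φ N).flow tc z),
                gK k tc ((Φ N).flow tc z) p.1 p.2) +
              ∑ p ∈ contactPairs (Torus.geometry (Fin 3)) (hsDiameter σ N) ((Φ N).flow tc z),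
                tailK tc ((Φ N).flow tc z) p.1 p.2 := by
        intro tc htc
        obtain ⟨-, htcI⟩ := (Set.Finite.mem_toFinset hfin).1 htc
        have hs : tc ∈ Icc 0 t := ⟨hτ.trans htcI.1.le, htcI.2.trans hτ't⟩
        calc ∑ p ∈ contactPairs (Torus.geometry (Fin 3)) (hsDiameter σ N) ((Φ N).flow tc z),
              virialK σ N tc ((Φ N).flow tc z) p.1 p.2
            ≤ ∑ p ∈ contactPairs (Torus.geometry (Fin 3)) (hsDiameter σ N) ((Φ N).flow tc z),
                ((1 + 2 * L) * (hsDiameter σ N * ∑ k : Fin 3, gK k tc ((Φ N).flow tc z) p.1 p.2) +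
                  tailK tc ((Φ N).flow tc z) p.1 p.2) := by
              refine Finset.sum_le_sum fun p hp => ?_
              obtain ⟨hne, hcs⟩ := mem_contactPairs.1 hp
              have hout : 0 < ⟪sepV N ((Φ N).flow tc z) p.1 p.2,
                  ((Φ N).flow tc z p.1).2 - ((Φ N).flow tc z p.2).2⟫_ℝ :=
                htraj.isOutgoing_of_mem_contactSet hne hcs
              have hcontact : ‖sepV N ((Φ N).flow tc z) p.1 p.2‖ = hsDiameter σ N := hcs.2
              exact virialK_le_windowPair hσ hηc hr hL hσc hcontact hout (hceil tc hs _) tc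
          _ = _ := by
              rw [Finset.sum_add_distrib, ← Finset.mul_sum, ← Finset.mul_sum, Finset.sum_comm]
      calc ∑ tc ∈ hfin.toFinset, ∑ p ∈ contactPairs (Torus.geometry (Fin 3)) (hsDiameter σ N) ((Φ N).flow tc z),
            virialK σ N tc ((Φ N).flow tc z) p.1 p.2
          ≤ ∑ tc ∈ hfin.toFinset, ((1 + 2 * L) * (hsDiameter σ N * ∑ k : Fin 3,
              ∑ p ∈ contactPairs (Torus.geometry (Fin 3)) (hsDiameter σ N) ((Φ N).flow tc z),
                gK k tc ((Φ N).flow tc z) p.1 p.2) +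
              ∑ p ∈ contactPairs (Torus.geometry (Fin 3)) (hsDiameter σ N) ((Φ N).flow tc z),
                tailK tc ((Φ N).flow tc z) p.1 p.2) := Finset.sum_le_sum htime
        _ = _ := by
            rw [Finset.sum_add_distrib, ← Finset.mul_sum, ← Finset.mul_sum, Finset.sum_comm]
    -- assemble
    have hsumK : ∑ k : Fin 3,
        (Literature.MathematicalPhysics.KineticTheory.collisionSum σ N (Φ N) τ' (fun _ : ℝ × T3 => (1 : ℝ))
            (fun a : ℝ => max 0 (min 1 (2 - 2 * a / ηc))) (evenMark k k) r z -
          Literature.MathematicalPhysics.KineticTheory.collisionSum σ N (Φ N) τ (fun _ : ℝ × T3 => (1 : ℝ))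
            (fun a : ℝ => max 0 (min 1 (2 - 2 * a / ηc))) (evenMark k k) r z) =
        hsDiameter σ N / ((N : ℝ) + 1) * ∑ k : Fin 3, (Φ N).collisionPairSum (Ioc τ τ') (gK k) z := by
      rw [Finset.mul_sum]
      exact Finset.sum_congr rfl fun k _ => hKdiff k hτ hττ'
    rw [hsumK, virialW, virialW, collisionPairSum_Ioc_split Φ hz hτ hττ' (virialK σ N)]
    have h1 := mul_le_mul_of_nonneg_left hmain hc0
    have h2 := mul_le_mul_of_nonneg_left htail hc0
    have hid : ((N : ℝ) + 1)⁻¹ * ((1 + 2 * L) * (hsDiameter σ N *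
        ∑ k : Fin 3, (Φ N).collisionPairSum (Ioc τ τ') (gK k) z) + (Φ N).collisionPairSum (Ioc τ τ') tailK z) =
        (1 + 2 * L) * (hsDiameter σ N / ((N : ℝ) + 1) * ∑ k : Fin 3, (Φ N).collisionPairSum (Ioc τ τ') (gK k) z) +
          ((N : ℝ) + 1)⁻¹ * (Φ N).collisionPairSum (Ioc τ τ') tailK z := by
      ring
    linarith

end

end Summit.AtomisticToContinuum.HydrodynamicLimit.Theorems.HemisphereAffineSlaving
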